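import Summits.NavierStokesRegularity.NavierStokesRegularity.Theorems.PerpetualPumpCircuitPumpActiveCore

/-!
# Pre-gate sup of the new bond of the Toda pump (crux `PerpetualPump.CircuitPump`,
# stmt-NavierStokesRegularity-1834; line `singular-clock-gspt`, sub-goal `toda_active_zsup` of
# `stub_clockBox`, Toda `m = 2` instance)

Under the hypotheses of `toda_active_core` (`Theorems/PerpetualPumpCircuitPumpActiveCore.lean`) the
Grönwall bound behind its conclusion (vi) holds at EVERY time `t ≤ t₃`, not only at `t₃`:
`z t ≤ ε A^{27} e^{400}` on `[0, t₃] ∩ [0, T]`. The two seed barriers of that proof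
(`seed_barrier` with the rise exponent `Φ = (3/2)v²/A² + 6t` on `[0, s]`, `s ≤ tg`, and with the
constant rate `lam(A + 2) − 1` on `[tg, s]`) are valid on every initial sub-interval because the
rate and seed budgets are integrals of non-negative bounds, hence monotone in the endpoint; the
bookkeeping `core_pt_zlog` (with `δ = 0` before the gate time, `δ = s − tg ≤ t₃ − tg` after it)
then gives `log z s ≤ log ε + 27 log A + 400` whenever `z s > 0`, and `z s ≥ 0` always.
[folklore]
-/

noncomputable section

-- the summit namespace `…NavierStokesRegularity.NavierStokesRegularity…` is the tree convention
set_option linter.dupNamespace false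

namespace Summit.NavierStokesRegularity.NavierStokesRegularity.Theorems.PerpetualPumpCircuitPump

open Set Filter Topology Literature.Analysis.ODE

/-- From the logarithmic form `log Z ≤ log ε + 27 log A + 400` to the product form
`Z ≤ ε A^{27} e^{400}`. [folklore] -/
theorem zsup_pt_exp {ε A L Z : ℝ} (hε : 0 < ε) (hA : 0 < A) (hL : Real.log A = L) (hZ : 0 < Z)
    (h : Real.log Z ≤ Real.log ε + 27 * L + 400) : Z ≤ ε * A ^ 27 * Real.exp 400 := by
  have h1 : Real.log Z ≤ Real.log (ε * A ^ 27 * Real.exp 400) := by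
    rw [Real.log_mul (by positivity) (Real.exp_pos _).ne', Real.log_mul hε.ne' (by positivity),
      Real.log_exp, Real.log_pow, hL]
    push_cast
    linarith only [h]
  exact (Real.log_le_log_iff hZ (by positivity)).mp h1

/-- **PRE-GATE SUP OF THE NEW BOND.** Under the hypotheses of `toda_active_core`, the Grönwall bound
behind its conclusion (vi) holds at every `t ≤ t₃` (the rate/seed budgets are monotone in `t`):
`z t ≤ ε A^{27} e^{400}` on `[0, t₃]`. The proof re-runs the two seed barriers of
`toda_active_core` (vi) on `[0, s]` (`s ≤ tg`) and `[tg, s]` (`s ≤ t₃`) and feeds them to the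
bookkeeping `core_pt_zlog`. [folklore] -/
theorem toda_active_zsup :
    ∀ (lam ν ε A T : ℝ) (u v w z e y : ℝ → ℝ), 1 < lam → lam ≤ 3 / 2 → ν = lam ^ (4 / 5 : ℝ) → 0 < ε → 0 < T → T ≤ 1 / 2 → 40000 ≤ A → -Real.log ε ≤ A / 5 → ε * (A + 2) ^ 2 ≤ 1 → Real.sqrt ε * A ≤ 1 / 40 → (-Real.log (1 - (-(Real.log ε) / 2 + Real.log (A / 8) + 11 / 5) / A) + (250 + 16 * Real.log A) / A) ≤ T → u 0 = A → v 0 = Real.sqrt ε → -ε ^ 2 ≤ w 0 → w 0 ≤ ε ^ (3 / 4 : ℝ) → 0 ≤ z 0 → z 0 ≤ ε ^ (3 / 2 : ℝ) → ContinuousOn u (Set.Icc 0 T) → ContinuousOn v (Set.Icc 0 T) → ContinuousOn w (Set.Icc 0 T) → ContinuousOn z (Set.Icc 0 T) → ContinuousOn e (Set.Icc 0 T) → ContinuousOn y (Set.Icc 0 T) → (∀ t ∈ Set.Ico 0 T, HasDerivWithinAt u (-u t - v t ^ 2 + lam⁻¹ * e t ^ 2 - ε * u t * v t) (Set.Ici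 t) t) → (∀ t ∈ Set.Ico 0 T, HasDerivWithinAt v (v t * (u t - w t) - v t + ε * u t ^ 2) (Set.Ici t) t) → (∀ t ∈ Set.Ico 0 T, HasDerivWithinAt w (-ν * w t + v t ^ 2 - lam * z t ^ 2 - ε * lam * w t * z t) (Set.Ici t) t) → (∀ t ∈ Set.Ico 0 T, HasDerivWithinAt z (z t * (lam * (w t - y t) - ν) + ε * lam * w t ^ 2) (Set.Ici t) t) → (∀ t ∈ Set.Icc 0 T, 0 ≤ e t ∧ e t ≤ 1) → (∀ t ∈ Set.Icc 0 T, |y t| ≤ 1) → (∀ t ∈ Set.Icc 0 T, z t ≤ 1) → ∀ t ∈ Set.Icc 0 T, t ≤ (-Real.log (1 - (-(Real.log ε) / 2 + Real.log (A / 8) + 11 / 5) / A) + (250 + 16 * Real.log A) / A) → z t ≤ ε * A ^ 27 * Real.exp 400 := by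
  intro lam ν ε A T u v w z e y hlam1 hlam2 hν hε hT0 hT hA hΛ hεA hsεA ht3T hu0 hv0 hw0lo hw0hi
    hz0 hz0' hu hv hw hz he hy hu' hv' hw' hz' heb hyb hzb
  obtain ⟨hI, tg, -, htgp, htg0, ht3tg, -, hrise, -, -, -⟩ :=
    toda_active_shift lam ν ε A T u v w z e y hlam1 hlam2 hν hε hT0 hT hA hΛ hεA hsεA ht3T hu0 hv0
      hw0lo hw0hi hz0 hz0' hu hv hw hz he hy hu' hv' hw' hz' heb hyb hzb
  set τp : ℝ := -Real.log (1 - (-(Real.log ε) / 2 + Real.log (A / 8) + 11 / 5) / A) with hτp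
  set t₃ : ℝ := τp + (250 + 16 * Real.log A) / A with ht₃
  obtain ⟨hν1, -, -, -, hεA1, -, -, -, h34, h32, -, -, -⟩ :=
    shift_numerics hlam1 hlam2 hν hε hA hΛ hεA hsεA
  have hA0 : 0 < A := by linarith only [hA]
  have hlam0 : 0 ≤ lam := by linarith only [hlam1]
  have hlogA0 : 0 ≤ Real.log A := Real.log_nonneg (by linarith only [hA])
  have h250A : (0 : ℝ) ≤ 250 / A := by positivity
  have hJ : t₃ - (τp + 250 / A) = 16 * Real.log A / A := by rw [ht₃]; field_simp; ring
  have h16A : 0 ≤ 16 * Real.log A / A := by positivity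
  have haJ : τp + 250 / A ≤ t₃ := by linarith only [hJ, h16A]
  have ha0 : 0 ≤ τp + 250 / A := by linarith only [htg0, htgp, h250A]
  have htgT : tg ≤ T := by linarith only [htgp, haJ, ht3T, h250A]
  have h16 : 16 * Real.log A / A ≤ 1 / 2 := by linarith only [hJ, ht3T, hT, ha0]
  have hz00 : z 0 ≤ ε := hz0'.trans h32
  have h255 : (0 : ℝ) ≤ (255 + 16 * Real.log A) / A :=
    div_nonneg (by linarith only [hlogA0]) hA0.le
  -- the refined rise bound for the new carrier
  have hwbar := core_wbar hν1 hε.le hA0 htgT hv hw hv' hw'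
    (fun t ht => core_pt_r hlam0 hlam2 hε.le hA hεA1 (hI t ht).2.2.2.2.2.2.1 (hzb t ht)
      (hI t ht).2.2.2.2.1)
    (fun t ht => (hI t ht).1) (fun t ht => (hrise t ht).2.2.1)
    (by linarith only [hw0hi, h34, sq_nonneg ε])
  -- first barrier on `[0, s]`, `s ≤ tg`
  have hbar1 : ∀ s, 0 ≤ s → s ≤ tg →
      z s ≤ Real.exp 4 * (z 0 + 3 / 2 * ε * (A / 64 + 3) ^ 2 * (s - 0)) := by
    intro s hs0 hstg
    have hsT : s ≤ T := hstg.trans htgT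
    have hΦc : ContinuousOn (fun y => 3 / 2 * v y ^ 2 / A ^ 2 + 6 * y) (Icc 0 s) :=
      ContinuousOn.mono (by fun_prop) (Icc_subset_Icc_right hsT)
    have hΦ' : ∀ t ∈ Ico 0 s, HasDerivWithinAt (fun y => 3 / 2 * v y ^ 2 / A ^ 2 + 6 * y)
        (3 / 2 * (2 * v t * (v t * (u t - w t) - v t + ε * u t ^ 2)) / A ^ 2 + 6) (Ici t) t := by
      intro t ht
      have ht' : t ∈ Ico 0 T := ⟨ht.1, ht.2.trans_le hsT⟩
      refine (((((hv' t ht').fun_pow 2).const_mul (3 / 2)).div_const (A ^ 2)).add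
        (((hasDerivAt_id' t).const_mul 6).hasDerivWithinAt)).congr_deriv ?_
      norm_num
    have hst1 : z s ≤ Real.exp (3 / 2 * v s ^ 2 / A ^ 2 + 6 * s - (3 / 2 * v 0 ^ 2 / A ^ 2 + 6 * 0)) *
        (z 0 + 3 / 2 * ε * (A / 64 + 3) ^ 2 * (s - 0)) :=
      seed_barrier (z := z) (Φ := fun y => 3 / 2 * v y ^ 2 / A ^ 2 + 6 * y)
        (c := fun t => lam * (w t - y t) - ν) (q := fun t => ε * lam * w t ^ 2)
        (Φ' := fun t => 3 / 2 * (2 * v t * (v t * (u t - w t) - v t + ε * u t ^ 2)) / A ^ 2 + 6)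
        hs0 (hz.mono (Icc_subset_Icc_right hsT)) hΦc
        (fun t ht => hz' t ⟨ht.1, ht.2.trans_le hsT⟩) hΦ'
        (fun t ht => by
          have ht' : t ∈ Icc 0 T := ⟨ht.1, ht.2.le.trans hsT⟩
          obtain ⟨-, -, hD, -⟩ := hrise t ⟨ht.1, ht.2.le.trans hstg⟩
          exact core_pt_rate_rise hlam1.le hlam2 hν1 hε.le hA0 (by linarith only [ht.2, hsT, hT])
            (hI t ht').1 (hyb t ht') hD (hI t ht').2.2.2.2.1
            (hwbar t ⟨ht.1, ht.2.le.trans hstg⟩))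
        (fun t ht => (hI t ⟨ht.1, ht.2.trans hsT⟩).2.2.2.2.2.2.1)
        (fun t ht => by
          have ht' : t ∈ Icc 0 T := ⟨ht.1, ht.2.le.trans hsT⟩
          obtain ⟨-, hv8, -, -⟩ := hrise t ⟨ht.1, ht.2.le.trans hstg⟩
          exact core_pt_q1 hlam0 hlam2 hε.le hA (hI t ht').1 hv8
            (by linarith only [ht.2, hsT, hT]) (hI t ht').2.2.2.2.1
            (hwbar t ⟨ht.1, ht.2.le.trans hstg⟩))
        (fun t ht => by
          obtain ⟨hv0t, -, -, -⟩ := hrise t ⟨ht.1, ht.2.trans hstg⟩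
          have hv00 : 0 ≤ v 0 := (hI 0 ⟨le_rfl, hT0.le⟩).1
          have h1 := div_le_div_of_nonneg_right (pow_le_pow_left₀ hv00 hv0t 2) (sq_nonneg A)
          show 3 / 2 * v 0 ^ 2 / A ^ 2 + 6 * 0 ≤ 3 / 2 * v t ^ 2 / A ^ 2 + 6 * t
          have e1 : 3 / 2 * v 0 ^ 2 / A ^ 2 = 3 / 2 * (v 0 ^ 2 / A ^ 2) := by ring
          have e2 : 3 / 2 * v t ^ 2 / A ^ 2 = 3 / 2 * (v t ^ 2 / A ^ 2) := by ring
          rw [e1, e2]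
          linarith only [h1, ht.1])
    have hE1 : Real.exp (3 / 2 * v s ^ 2 / A ^ 2 + 6 * s - (3 / 2 * v 0 ^ 2 / A ^ 2 + 6 * 0)) ≤
        Real.exp 4 := by
      refine Real.exp_le_exp.mpr ?_
      obtain ⟨-, hv8, -, -⟩ := hrise s ⟨hs0, hstg⟩
      have hv0s : 0 ≤ v s := (hI s ⟨hs0, hsT⟩).1
      have e1 : 3 / 2 * v s ^ 2 / A ^ 2 ≤ 3 / 128 := by
        rw [div_le_iff₀ (by positivity)]
        nlinarith only [pow_le_pow_left₀ hv0s hv8 2]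
      have e2 : 0 ≤ 3 / 2 * v 0 ^ 2 / A ^ 2 := by positivity
      linarith only [e1, e2, hsT, hT, hs0]
    have hin1 : 0 ≤ z 0 + 3 / 2 * ε * (A / 64 + 3) ^ 2 * (s - 0) := by
      have h1 : 0 ≤ 3 / 2 * ε * (A / 64 + 3) ^ 2 * (s - 0) :=
        mul_nonneg (by positivity) (by linarith only [hs0])
      linarith only [h1, hz0]
    exact hst1.trans (mul_le_mul_of_nonneg_right hE1 hin1)
  -- second barrier on `[tg, s]`, `s ≤ T`
  have hbar2 : ∀ s, tg ≤ s → s ≤ T → z s ≤ Real.exp ((lam * (A + 2) - 1) * (s - tg)) *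
      (z tg + 3 / 2 * ε * (A + 1) ^ 2 * (s - tg)) := by
    intro s htgs hsT
    have hK' : ∀ t ∈ Ico tg s, HasDerivWithinAt (fun y => (lam * (A + 2) - 1) * y)
        (lam * (A + 2) - 1) (Ici t) t := fun t _ => by
      simpa using ((hasDerivAt_id' t).const_mul (lam * (A + 2) - 1)).hasDerivWithinAt
    have hst2 : z s ≤ Real.exp ((lam * (A + 2) - 1) * s - (lam * (A + 2) - 1) * tg) *
        (z tg + 3 / 2 * ε * (A + 1) ^ 2 * (s - tg)) :=
      seed_barrier (z := z) (Φ := fun y => (lam * (A + 2) - 1) * y)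
        (c := fun t => lam * (w t - y t) - ν) (q := fun t => ε * lam * w t ^ 2)
        (Φ' := fun _ => lam * (A + 2) - 1) htgs
        (hz.mono (Icc_subset_Icc htg0 hsT)) (by fun_prop)
        (fun t ht => hz' t ⟨htg0.trans ht.1, ht.2.trans_le hsT⟩) hK'
        (fun t ht => by
          have ht' : t ∈ Icc 0 T := ⟨htg0.trans ht.1, (ht.2.trans_le hsT).le⟩
          exact core_pt_rate_flip hlam0 hν1 (hyb t ht') (hI t ht').2.2.2.2.2.1)
        (fun t ht => (hI t ⟨htg0.trans ht.1, ht.2.trans hsT⟩).2.2.2.2.2.2.1)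
        (fun t ht => by
          have ht' : t ∈ Icc 0 T := ⟨htg0.trans ht.1, (ht.2.trans_le hsT).le⟩
          exact core_pt_q2 hlam0 hlam2 hε.le hA (hI t ht').2.2.2.2.1 (hI t ht').2.2.2.2.2.1)
        (fun t ht => by
          show (lam * (A + 2) - 1) * tg ≤ (lam * (A + 2) - 1) * t
          exact mul_le_mul_of_nonneg_left ht.1 (by nlinarith only [hlam1, hA]))
    have hKδ : (lam * (A + 2) - 1) * s - (lam * (A + 2) - 1) * tg =
        (lam * (A + 2) - 1) * (s - tg) := by ring
    rwa [hKδ] at hst2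
  -- conclusion at every `t ≤ t₃`
  intro t ht htt₃
  have hzt0 : 0 ≤ z t := (hI t ht).2.2.2.2.2.2.1
  rcases hzt0.eq_or_lt with hzt | hzt
  · rw [← hzt]; positivity
  refine zsup_pt_exp hε hA0 rfl hzt ?_
  rcases le_total t tg with httg | htgt
  · exact core_pt_zlog (K := 0) (δ := 0) hA hε rfl hlogA0 h16 hz0 hz00 ht.1 (ht.2.trans hT) le_rfl
      (hbar1 t ht.1 httg) (by linarith only [hA]) le_rfl h255
      (by rw [mul_zero, Real.exp_zero, one_mul, mul_zero, add_zero]) hzt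
  · exact core_pt_zlog hA hε rfl hlogA0 h16 hz0 hz00 htg0 (htgT.trans hT) le_rfl
      (hbar1 tg htg0 le_rfl) (by nlinarith only [hlam2, hA]) (by linarith only [htgt])
      (by linarith only [ht3tg, htt₃]) (hbar2 t htgt ht.2) hzt

end Summit.NavierStokesRegularity.NavierStokesRegularity.Theorems.PerpetualPumpCircuitPump
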